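import Summits.QuantumFields.YangMills.Theorems.UnitScaleTiltProp7SkewSplitFrobeniusRow
import Summits.QuantumFields.YangMills.Theorems.UnitScaleTiltProp7TransverseRowOfQTwSTubeComparison
import Summits.QuantumFields.YangMills.Theorems.UnitScaleTiltProp7QTwSRealityOfRegPr
import Summits.QuantumFields.YangMills.Theorems.UnitScaleTiltProp7RieszTauFrobNormT3
import HarnessLib

/-!
# Route `UnitScaleTilt`, crux «MinimiserStabilityRegPr» (stmt-QuantumFields-19200), stub `stub_existenceMinimalOrbit` (EX), pen (b1) glue, FILE 5 —
# **THE TUBE-COMPARISON ROW `hQcmp` FOR EVERY `M₂(ℂ)` CARRIER FROM ITS FROBENIUS FORM ON ANTI-HERMITIAN CARRIERS, AT A PRINTED-REGULAR BACKGROUND**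

Cell `ym3-torus`, twin-width seat `ym-ust-19200-w7` (gen 10).  THEOREMS ONLY (0 `def`, 0 `sorry`); `--supports stmt-QuantumFields-19200 --as helper`, count-neutral.
YM₃ on T³ is ladder rung R3 — NOT d = 4, NOT infinite volume, NOT a mass gap, NOT Clay; nothing here claims a print row, the stub or the crux.

WHAT.  ✓`Prop7SkewSplitFrobeniusRow.row_of_skew_row` instantiated with the two maps of the displayed row `hQcmp` of ✓`Prop7TransverseRowOfQTwSTubeComparison` ∕
✓`Prop7TransverseRowOfTubeRowRegPr`: the corner tube `T^{str}_{U₀}` (a sum of `conjR` by UNITARY transports — `ᴴ`-compatible, §1) and print's `QTwS U₀` (`ᴴ`-compatible at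
`RegPr` by ✓`Prop7SymAvgTwSym.QTwS_star_comm_of_regPr`, the reality theorem of the p03∕w-lineage).  RESULT (§2): at `RegPr F n K ε₀ U₀` with `10¹²L³ε₀ ≤ 1`, a Frobenius row
`Σ_c‖T^{str}A(c)‖_F² ≤ α·Σ_{c'}‖QTwS U₀ A c'‖_F² + β·Σ_b‖A b‖_F²` for ANTI-HERMITIAN carriers `A` gives, for EVERY carrier `X`, the op-norm row
`Σ_c‖T^{str}X(c)‖² ≤ 2α·Σ_{c'}‖QTwS U₀ X c'‖² + 2β·Σ_b‖X b‖²`; with `α = (ℓ^d)²`, `β = ½·Cq·ε₀²·ℓ^dℓ²` this is `hQcmp` VERBATIM (§3).  So the (b1) supplier may be proved on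
𝔲(2)-valued carriers only (where ✓`Prop7QSymEqTrueLinIter…` and the true-lin letters live, plus the scalar direction ✓`Prop7SymAvgTwSym.QTwS_apply_smul_one_of_regPr`).
[Balaban1985Averaging] (18)–(20) p.21; [Balaban1985BackgroundPropagators] (3.13)–(3.15) p.393; [Balaban1985Variational] (51) p.286.
-/

set_option autoImplicit false

noncomputable section

open scoped BigOperators Matrix.Norms.L2Operator Matrix InnerProductSpace

namespace Summit.QuantumFields.YangMills.Theorems.Prop7TubeComparisonRowOfSkewRow

open Literature.MathematicalPhysics.QuantumFieldTheory.Balaban1983to89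
open Finset B1RG242Torus
open B7Prop1Explicit (treeWord)
open B7Prop2Explicit (unitaryUnits hol_mem_of)
open B7Eq78Linearization (conjR conjR_apply)
open B10Eq27TorusAxialLog (holT unitsField toUField hol_pull_zero unitsField_mem_unitaryUnits)
open T3ContinuumYM3Torus (T3Family)
open T3PrintedRegularMinimiser (RegPr)
open Summit.QuantumFields.YangMills.Theorems.Prop7SectET3HilbertLetters (W₂ frobEquiv)
open Summit.QuantumFields.YangMills.Theorems.Prop7SymAvgTwSym (QTwS QTwS_star_comm_of_regPr)
open Summit.QuantumFields.YangMills.Theorems.Prop7SkewSplitFrobeniusRow (row_of_skew_row)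
open Summit.QuantumFields.YangMills.Theorems.Prop7RieszTauFrobNorm (norm_le_norm_frobEquiv_symm norm_sq_frobEquiv_symm sum_norm_sq_le_two_mul_opNorm_sq)

variable (F : T3Family) (n K : ℕ)

/-! ## §1 The corner tube is `ᴴ`-compatible (unitary transports) -/

/-- Transports of the `SU(2)` background read in `M₂(ℂ)ˣ` are unitary units. [cite: Balaban1985RegularSpaces, (1.1) p.76] -/
theorem holT_bg_mem_unitaryUnits (U₀ : GaugeField (F.P K) 0 (Matrix.specialUnitaryGroup (Fin 2) ℂ)) (y : Site (F.P K) 0) (w : List (B7Prop1Explicit.Letter (F.P K).d)) :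
    holT (unitsField (toUField U₀)) y w ∈ unitaryUnits (Matrix (Fin 2) (Fin 2) ℂ) := by
  rw [← hol_pull_zero]
  exact hol_mem_of (V := B10Eq27TorusAxialLog.pull (unitsField (toUField U₀)) y) (fun _ _ => unitsField_mem_unitaryUnits (toUField U₀) _) 0 w

/-- `(R(u)a)ᴴ = R(u)(aᴴ)` for a unitary unit `u` of `M₂(ℂ)`. [cite: Balaban1985RegularSpaces, (1.1) p.76] -/
theorem conjTranspose_conjR {u : (Matrix (Fin 2) (Fin 2) ℂ)ˣ} (hu : u ∈ unitaryUnits (Matrix (Fin 2) (Fin 2) ℂ)) (a : Matrix (Fin 2) (Fin 2) ℂ) :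
    (conjR u a)ᴴ = conjR u aᴴ := by
  have hu' : ((u : (Matrix (Fin 2) (Fin 2) ℂ)ˣ) : Matrix (Fin 2) (Fin 2) ℂ) ∈ unitary (Matrix (Fin 2) (Fin 2) ℂ) := hu
  have hinv : ((u⁻¹ : (Matrix (Fin 2) (Fin 2) ℂ)ˣ) : Matrix (Fin 2) (Fin 2) ℂ) = star (u : Matrix (Fin 2) (Fin 2) ℂ) :=
    Units.inv_eq_of_mul_eq_one_right (Unitary.mul_star_self_of_mem hu')
  rw [conjR_apply, conjR_apply, hinv, Matrix.star_eq_conjTranspose, Matrix.conjTranspose_mul, Matrix.conjTranspose_mul,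
    Matrix.conjTranspose_conjTranspose, Matrix.mul_assoc]

/-- `ᴴ` passes through a double sum of unitary conjugations: `(Σᵢ Σₖ R(uᵢₖ)Yᵢₖ)ᴴ = Σᵢ Σₖ R(uᵢₖ)(Yᵢₖᴴ)`. [cite: Balaban1985RegularSpaces, (1.1) p.76] -/
theorem conjTranspose_sum_sum_conjR {ι κ : Type*} (s : Finset ι) (t : Finset κ) (u : ι → κ → (Matrix (Fin 2) (Fin 2) ℂ)ˣ)
    (hu : ∀ i k, u i k ∈ unitaryUnits (Matrix (Fin 2) (Fin 2) ℂ)) (Y : ι → κ → Matrix (Fin 2) (Fin 2) ℂ) :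
    (∑ i ∈ s, ∑ k ∈ t, conjR (u i k) (Y i k))ᴴ = ∑ i ∈ s, ∑ k ∈ t, conjR (u i k) (Y i k)ᴴ := by
  rw [Matrix.conjTranspose_sum]
  refine Finset.sum_congr rfl fun i _ => ?_
  rw [Matrix.conjTranspose_sum]
  exact Finset.sum_congr rfl fun k _ => conjTranspose_conjR (hu i k) _

/-- ★ **THE CORNER TUBE COMMUTES WITH `ᴴ`**: `T^{str}_{U₀}(Xᴴ)(c) = (T^{str}_{U₀}X(c))ᴴ`. [cite: Balaban1984PropagatorsI, (1.18) p.20; Balaban1985RegularSpaces, (1.1) p.76] -/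
theorem tubeStr_conjTranspose (U₀ : GaugeField (F.P K) 0 (Matrix.specialUnitaryGroup (Fin 2) ℂ)) (X : PBond (F.P K) 0 → Matrix (Fin 2) (Fin 2) ℂ)
    (c : PBond (F.P K) (K - n)) :
    (∑ r : Fin (F.P K).d → Fin ((F.P K).L ^ (K - n)), ∑ t ∈ range ((F.P K).L ^ (K - n)),
        conjR (holT (unitsField (toUField U₀)) (Site.fibreSite 0 (K - n) c.src fun _ => ⟨0, pow_pos (F.P K).L_pos (K - n)⟩)
              (treeWord fun ν => ((r ν : ℕ) : ℤ))
            * holT (unitsField (toUField U₀)) (Site.fibreSite 0 (K - n) c.src r) (List.replicate t (c.dir, true)))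
          ((fun b => (X b)ᴴ) ⟨(fun z : Site (F.P K) 0 => z.shift c.dir)^[t] (Site.fibreSite 0 (K - n) c.src r), c.dir⟩))
      = (∑ r : Fin (F.P K).d → Fin ((F.P K).L ^ (K - n)), ∑ t ∈ range ((F.P K).L ^ (K - n)),
        conjR (holT (unitsField (toUField U₀)) (Site.fibreSite 0 (K - n) c.src fun _ => ⟨0, pow_pos (F.P K).L_pos (K - n)⟩)
              (treeWord fun ν => ((r ν : ℕ) : ℤ))
            * holT (unitsField (toUField U₀)) (Site.fibreSite 0 (K - n) c.src r) (List.replicate t (c.dir, true)))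
          (X ⟨(fun z : Site (F.P K) 0 => z.shift c.dir)^[t] (Site.fibreSite 0 (K - n) c.src r), c.dir⟩))ᴴ := by
  exact (conjTranspose_sum_sum_conjR (Finset.univ : Finset (Fin (F.P K).d → Fin ((F.P K).L ^ (K - n)))) (range ((F.P K).L ^ (K - n)))
    (fun r t => holT (unitsField (toUField U₀)) (Site.fibreSite 0 (K - n) c.src fun _ => ⟨0, pow_pos (F.P K).L_pos (K - n)⟩)
          (treeWord fun ν => ((r ν : ℕ) : ℤ))
        * holT (unitsField (toUField U₀)) (Site.fibreSite 0 (K - n) c.src r) (List.replicate t (c.dir, true)))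
    (fun r t => (unitaryUnits (Matrix (Fin 2) (Fin 2) ℂ)).mul_mem (holT_bg_mem_unitaryUnits F K U₀ _ _) (holT_bg_mem_unitaryUnits F K U₀ _ _))
    (fun r t => X ⟨(fun z : Site (F.P K) 0 => z.shift c.dir)^[t] (Site.fibreSite 0 (K - n) c.src r), c.dir⟩)).symm

/-! ## §2 The op-norm row for every carrier from the Frobenius row on anti-Hermitian carriers -/

variable (h : n ≤ K)

/-- ★★★ **`hQcmp`-TYPE ROWS EXTEND FROM ANTI-HERMITIAN TO ALL CARRIERS** at `RegPr F n K ε₀ U₀` (`10¹²L³ε₀ ≤ 1`): a Frobenius row with constants `0 ≤ α, β` for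
anti-Hermitian carriers gives the op-norm row with `2α, 2β` for every carrier (`|·| ≤ ‖·‖_F`, `‖·‖_F² ≤ 2|·|²` on `M₂(ℂ)`).
[cite: Balaban1985Averaging, (18)-(20) p.21; Balaban1985BackgroundPropagators, (3.13)-(3.15) p.393; Balaban1985Variational, (51) p.286] -/
theorem opRow_of_skewFrobRow {ε₀ : ℝ} (hε₀ : 0 < ε₀) (hWε : 10 ^ 12 * (F.L : ℝ) ^ 3 * ε₀ ≤ 1)
    (U₀ : GaugeField (F.P K) 0 (Matrix.specialUnitaryGroup (Fin 2) ℂ)) (hreg : RegPr F n K ε₀ U₀) {α β : ℝ} (hα : 0 ≤ α) (hβ : 0 ≤ β)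
    (hrow : ∀ A : PBond (F.P K) 0 → Matrix (Fin 2) (Fin 2) ℂ, (∀ b, (A b)ᴴ = -A b) →
      ∑ c : PBond (F.P K) (K - n), ‖(frobEquiv.symm (∑ r : Fin (F.P K).d → Fin ((F.P K).L ^ (K - n)), ∑ t ∈ range ((F.P K).L ^ (K - n)),
        conjR (holT (unitsField (toUField U₀)) (Site.fibreSite 0 (K - n) c.src fun _ => ⟨0, pow_pos (F.P K).L_pos (K - n)⟩)
              (treeWord fun ν => ((r ν : ℕ) : ℤ))
            * holT (unitsField (toUField U₀)) (Site.fibreSite 0 (K - n) c.src r) (List.replicate t (c.dir, true)))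
          (A ⟨(fun z : Site (F.P K) 0 => z.shift c.dir)^[t] (Site.fibreSite 0 (K - n) c.src r), c.dir⟩)) : W₂)‖ ^ 2
      ≤ α * ∑ c' : PBond (F.P n) 0, ‖(frobEquiv.symm (QTwS F n K h U₀ A c') : W₂)‖ ^ 2
        + β * ∑ b : PBond (F.P K) 0, ‖(frobEquiv.symm (A b) : W₂)‖ ^ 2)
    (X : PBond (F.P K) 0 → Matrix (Fin 2) (Fin 2) ℂ) :
    ∑ c : PBond (F.P K) (K - n), ‖∑ r : Fin (F.P K).d → Fin ((F.P K).L ^ (K - n)), ∑ t ∈ range ((F.P K).L ^ (K - n)),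
        conjR (holT (unitsField (toUField U₀)) (Site.fibreSite 0 (K - n) c.src fun _ => ⟨0, pow_pos (F.P K).L_pos (K - n)⟩)
              (treeWord fun ν => ((r ν : ℕ) : ℤ))
            * holT (unitsField (toUField U₀)) (Site.fibreSite 0 (K - n) c.src r) (List.replicate t (c.dir, true)))
          (X ⟨(fun z : Site (F.P K) 0 => z.shift c.dir)^[t] (Site.fibreSite 0 (K - n) c.src r), c.dir⟩)‖ ^ 2
      ≤ 2 * α * ∑ c' : PBond (F.P n) 0, ‖QTwS F n K h U₀ X c'‖ ^ 2 + 2 * β * ∑ b : PBond (F.P K) 0, ‖X b‖ ^ 2 := by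
  classical
  -- windows and the positivity instances the reality theorem wants
  have hL3 : (3 : ℝ) ≤ (F.L : ℝ) := by
    have h3 : 3 ≤ F.L := by obtain ⟨a, ha⟩ := F.hL.1; have := F.hL.2; omega
    exact_mod_cast h3
  have hLpos : (0 : ℝ) < (F.L : ℝ) := by linarith
  haveI : Fact (0 < (F.L : ℝ)) := ⟨hLpos⟩
  haveI : Fact (0 < ((F.L : ℝ)⁻¹) ^ (K - n)) := ⟨pow_pos (inv_pos.mpr hLpos) _⟩
  have hWe : 10 ^ 9 * (F.L : ℝ) ^ 2 * ε₀ ≤ 1 := by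
    have h1 : (F.L : ℝ) ^ 2 ≤ (F.L : ℝ) ^ 3 := pow_le_pow_right₀ (by linarith) (by norm_num)
    nlinarith [h1, hε₀.le, pow_nonneg hLpos.le 2]
  -- the two maps as ℂ-linear maps of matrix fields
  let T : (PBond (F.P K) 0 → Matrix (Fin 2) (Fin 2) ℂ) →ₗ[ℂ] (PBond (F.P K) (K - n) → Matrix (Fin 2) (Fin 2) ℂ) :=
    { toFun := fun X c => ∑ r : Fin (F.P K).d → Fin ((F.P K).L ^ (K - n)), ∑ t ∈ range ((F.P K).L ^ (K - n)),
        conjR (holT (unitsField (toUField U₀)) (Site.fibreSite 0 (K - n) c.src fun _ => ⟨0, pow_pos (F.P K).L_pos (K - n)⟩)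
              (treeWord fun ν => ((r ν : ℕ) : ℤ))
            * holT (unitsField (toUField U₀)) (Site.fibreSite 0 (K - n) c.src r) (List.replicate t (c.dir, true)))
          (X ⟨(fun z : Site (F.P K) 0 => z.shift c.dir)^[t] (Site.fibreSite 0 (K - n) c.src r), c.dir⟩)
      map_add' := fun X Y => by
        funext c
        simp only [Pi.add_apply, conjR_apply, mul_add, add_mul, Finset.sum_add_distrib]
      map_smul' := fun a X => by
        funext c
        simp only [Pi.smul_apply, conjR_apply, Matrix.mul_smul, Matrix.smul_mul, Finset.smul_sum, RingHom.id_apply] }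
  let Q : (PBond (F.P K) 0 → Matrix (Fin 2) (Fin 2) ℂ) →ₗ[ℂ] (PBond (F.P n) 0 → Matrix (Fin 2) (Fin 2) ℂ) := (QTwS F n K h U₀ : _ →L[ℂ] _)
  have hT : ∀ (X : PBond (F.P K) 0 → Matrix (Fin 2) (Fin 2) ℂ) (c : PBond (F.P K) (K - n)), T (fun b => (X b)ᴴ) c = (T X c)ᴴ :=
    fun X c => tubeStr_conjTranspose F n K U₀ X c
  have hQ : ∀ (X : PBond (F.P K) 0 → Matrix (Fin 2) (Fin 2) ℂ) (d : PBond (F.P n) 0), Q (fun b => (X b)ᴴ) d = (Q X d)ᴴ := by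
    intro X d
    have hs := QTwS_star_comm_of_regPr F h hε₀ hε₀ hWe hWε U₀ hreg X
    have e1 : (fun b => (X b)ᴴ) = star X := by funext b; rw [Pi.star_apply, Matrix.star_eq_conjTranspose]
    rw [e1]
    change QTwS F n K h U₀ (star X) d = (QTwS F n K h U₀ X d)ᴴ
    rw [hs, Pi.star_apply, Matrix.star_eq_conjTranspose]
  -- the Frobenius row for every carrier
  have hF := row_of_skew_row T Q hT hQ α β (fun A hA => hrow A hA) X
  -- op ≤ Frobenius on the left, Frobenius ≤ 2·op on the right
  have hL : ∑ c : PBond (F.P K) (K - n), ‖T X c‖ ^ 2 ≤ ∑ c : PBond (F.P K) (K - n), ‖(frobEquiv.symm (T X c) : W₂)‖ ^ 2 :=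
    Finset.sum_le_sum fun c _ => pow_le_pow_left₀ (norm_nonneg _) (norm_le_norm_frobEquiv_symm _) 2
  have hRQ : ∑ c' : PBond (F.P n) 0, ‖(frobEquiv.symm (Q X c') : W₂)‖ ^ 2 ≤ 2 * ∑ c' : PBond (F.P n) 0, ‖QTwS F n K h U₀ X c'‖ ^ 2 := by
    rw [Finset.mul_sum]
    exact Finset.sum_le_sum fun c' _ => by rw [norm_sq_frobEquiv_symm]; exact sum_norm_sq_le_two_mul_opNorm_sq _
  have hRX : ∑ b : PBond (F.P K) 0, ‖(frobEquiv.symm (X b) : W₂)‖ ^ 2 ≤ 2 * ∑ b : PBond (F.P K) 0, ‖X b‖ ^ 2 := by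
    rw [Finset.mul_sum]
    exact Finset.sum_le_sum fun b _ => by rw [norm_sq_frobEquiv_symm]; exact sum_norm_sq_le_two_mul_opNorm_sq _
  have h1 := mul_le_mul_of_nonneg_left hRQ hα
  have h2 := mul_le_mul_of_nonneg_left hRX hβ
  calc ∑ c : PBond (F.P K) (K - n), ‖T X c‖ ^ 2
      ≤ α * ∑ c' : PBond (F.P n) 0, ‖(frobEquiv.symm (Q X c') : W₂)‖ ^ 2 + β * ∑ b : PBond (F.P K) 0, ‖(frobEquiv.symm (X b) : W₂)‖ ^ 2 := hL.trans hF
    _ ≤ 2 * α * ∑ c' : PBond (F.P n) 0, ‖QTwS F n K h U₀ X c'‖ ^ 2 + 2 * β * ∑ b : PBond (F.P K) 0, ‖X b‖ ^ 2 := by linarith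

/-! ## §3 The displayed row `hQcmp` of the γ-row doors, verbatim -/

/-- ★★★ **`hQcmp` FOR EVERY CARRIER FROM THE ANTI-HERMITIAN FROBENIUS COMPARISON**: at `RegPr F n K ε₀ U₀` (`10¹²L³ε₀ ≤ 1`), if for every ANTI-HERMITIAN carrier `A`
`Σ_c‖T^{str}A(c)‖_F² ≤ (ℓ^d)²·Σ_{c'}‖QTwS U₀ A c'‖_F² + ½Cq·ε₀²·ℓ^dℓ²·Σ_b‖A b‖_F²` (`0 ≤ Cq`), then for EVERY carrier `X` the row `hQcmp` of
✓`Prop7TransverseRowOfQTwSTubeComparison.sum_normSq_le_curl_sq_add_divB_sq_add_QTwS_of_tubeRow` ∕ ✓`Prop7TransverseRowOfTubeRowRegPr.hT_of_tubeRow` holds VERBATIM (`ε := ε₀`).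
[cite: Balaban1984PropagatorsI, (1.18) p.20; Balaban1985BackgroundPropagators, (3.13)-(3.15) p.393; Balaban1985Averaging, (18)-(20) p.21] -/
theorem tubeRow_of_skewFrobRow {ε₀ : ℝ} (hε₀ : 0 < ε₀) (hWε : 10 ^ 12 * (F.L : ℝ) ^ 3 * ε₀ ≤ 1)
    (U₀ : GaugeField (F.P K) 0 (Matrix.specialUnitaryGroup (Fin 2) ℂ)) (hreg : RegPr F n K ε₀ U₀) {Cq : ℝ} (hCq : 0 ≤ Cq)
    (hrow : ∀ A : PBond (F.P K) 0 → Matrix (Fin 2) (Fin 2) ℂ, (∀ b, (A b)ᴴ = -A b) →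
      ∑ c : PBond (F.P K) (K - n), ‖(frobEquiv.symm (∑ r : Fin (F.P K).d → Fin ((F.P K).L ^ (K - n)), ∑ t ∈ range ((F.P K).L ^ (K - n)),
        conjR (holT (unitsField (toUField U₀)) (Site.fibreSite 0 (K - n) c.src fun _ => ⟨0, pow_pos (F.P K).L_pos (K - n)⟩)
              (treeWord fun ν => ((r ν : ℕ) : ℤ))
            * holT (unitsField (toUField U₀)) (Site.fibreSite 0 (K - n) c.src r) (List.replicate t (c.dir, true)))
          (A ⟨(fun z : Site (F.P K) 0 => z.shift c.dir)^[t] (Site.fibreSite 0 (K - n) c.src r), c.dir⟩)) : W₂)‖ ^ 2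
      ≤ (((F.L : ℝ) ^ (K - n)) ^ (F.P K).d) ^ 2 * ∑ c' : PBond (F.P n) 0, ‖(frobEquiv.symm (QTwS F n K h U₀ A c') : W₂)‖ ^ 2
        + (2⁻¹ * Cq * ε₀ ^ 2 * (((F.L : ℝ) ^ (K - n)) ^ (F.P K).d * ((F.L : ℝ) ^ (K - n)) ^ 2)) * ∑ b : PBond (F.P K) 0, ‖(frobEquiv.symm (A b) : W₂)‖ ^ 2)
    (X : PBond (F.P K) 0 → Matrix (Fin 2) (Fin 2) ℂ) :
    ∑ c : PBond (F.P K) (K - n), ‖∑ r : Fin (F.P K).d → Fin ((F.P K).L ^ (K - n)), ∑ t ∈ range ((F.P K).L ^ (K - n)),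
        conjR (holT (unitsField (toUField U₀)) (Site.fibreSite 0 (K - n) c.src fun _ => ⟨0, pow_pos (F.P K).L_pos (K - n)⟩)
              (treeWord fun ν => ((r ν : ℕ) : ℤ))
            * holT (unitsField (toUField U₀)) (Site.fibreSite 0 (K - n) c.src r) (List.replicate t (c.dir, true)))
          (X ⟨(fun z : Site (F.P K) 0 => z.shift c.dir)^[t] (Site.fibreSite 0 (K - n) c.src r), c.dir⟩)‖ ^ 2
      ≤ 2 * (((F.L : ℝ) ^ (K - n)) ^ (F.P K).d) ^ 2 * ∑ c' : PBond (F.P n) 0, ‖QTwS F n K h U₀ X c'‖ ^ 2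
        + Cq * ε₀ ^ 2 * (((F.L : ℝ) ^ (K - n)) ^ (F.P K).d * ((F.L : ℝ) ^ (K - n)) ^ 2) * ∑ b : PBond (F.P K) 0, ‖X b‖ ^ 2 := by
  have hLpos : (0 : ℝ) < (F.L : ℝ) := by
    have h3 : 3 ≤ F.L := by obtain ⟨a, ha⟩ := F.hL.1; have := F.hL.2; omega
    have : (3 : ℝ) ≤ (F.L : ℝ) := by exact_mod_cast h3
    linarith
  have hβ : 0 ≤ 2⁻¹ * Cq * ε₀ ^ 2 * (((F.L : ℝ) ^ (K - n)) ^ (F.P K).d * ((F.L : ℝ) ^ (K - n)) ^ 2) := by positivity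
  have hmain := opRow_of_skewFrobRow F n K h hε₀ hWε U₀ hreg (sq_nonneg _) hβ hrow X
  have e : 2 * (2⁻¹ * Cq * ε₀ ^ 2 * (((F.L : ℝ) ^ (K - n)) ^ (F.P K).d * ((F.L : ℝ) ^ (K - n)) ^ 2))
      = Cq * ε₀ ^ 2 * (((F.L : ℝ) ^ (K - n)) ^ (F.P K).d * ((F.L : ℝ) ^ (K - n)) ^ 2) := by ring
  rw [e] at hmain
  exact hmain

/-- ★★★ **`hQcmp` WITH A FREE COMPARISON CONSTANT `CT`, FOR EVERY CARRIER, FROM THE ANTI-HERMITIAN FROBENIUS COMPARISON** (v2 of §3, matching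
✓`Prop7TransverseRowOfQTwSTubeComparison.sum_normSq_le_curl_sq_add_divB_sq_add_QTwS_of_tubeRowC`): at `RegPr F n K ε₀ U₀` (`10¹²L³ε₀ ≤ 1`), if for every ANTI-HERMITIAN
carrier `A` `Σ_c‖T^{str}A(c)‖_F² ≤ ½CT·(ℓ^d)²·Σ_{c'}‖QTwS U₀ A c'‖_F² + ½Cq·ε₀²·ℓ^dℓ²·Σ_b‖A b‖_F²` (`0 ≤ CT, Cq`), then for EVERY carrier `X`
`Σ_c‖T^{str}X(c)‖² ≤ CT·(ℓ^d)²·Σ_{c'}‖QTwS U₀ X c'‖² + Cq·ε₀²·ℓ^dℓ²·Σ_b‖X b‖²` (the located supplier gives `½CT = 2`, i.e. `CT = 4`).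
[cite: Balaban1984PropagatorsI, (1.18) p.20; Balaban1985BackgroundPropagators, (3.13)-(3.15) p.393; Balaban1985Averaging, (18)-(20) p.21] -/
theorem tubeRowC_of_skewFrobRow {ε₀ : ℝ} (hε₀ : 0 < ε₀) (hWε : 10 ^ 12 * (F.L : ℝ) ^ 3 * ε₀ ≤ 1)
    (U₀ : GaugeField (F.P K) 0 (Matrix.specialUnitaryGroup (Fin 2) ℂ)) (hreg : RegPr F n K ε₀ U₀) {CT Cq : ℝ} (hCT : 0 ≤ CT) (hCq : 0 ≤ Cq)
    (hrow : ∀ A : PBond (F.P K) 0 → Matrix (Fin 2) (Fin 2) ℂ, (∀ b, (A b)ᴴ = -A b) →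
      ∑ c : PBond (F.P K) (K - n), ‖(frobEquiv.symm (∑ r : Fin (F.P K).d → Fin ((F.P K).L ^ (K - n)), ∑ t ∈ range ((F.P K).L ^ (K - n)),
        conjR (holT (unitsField (toUField U₀)) (Site.fibreSite 0 (K - n) c.src fun _ => ⟨0, pow_pos (F.P K).L_pos (K - n)⟩)
              (treeWord fun ν => ((r ν : ℕ) : ℤ))
            * holT (unitsField (toUField U₀)) (Site.fibreSite 0 (K - n) c.src r) (List.replicate t (c.dir, true)))
          (A ⟨(fun z : Site (F.P K) 0 => z.shift c.dir)^[t] (Site.fibreSite 0 (K - n) c.src r), c.dir⟩)) : W₂)‖ ^ 2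
      ≤ (2⁻¹ * CT * (((F.L : ℝ) ^ (K - n)) ^ (F.P K).d) ^ 2) * ∑ c' : PBond (F.P n) 0, ‖(frobEquiv.symm (QTwS F n K h U₀ A c') : W₂)‖ ^ 2
        + (2⁻¹ * Cq * ε₀ ^ 2 * (((F.L : ℝ) ^ (K - n)) ^ (F.P K).d * ((F.L : ℝ) ^ (K - n)) ^ 2)) * ∑ b : PBond (F.P K) 0, ‖(frobEquiv.symm (A b) : W₂)‖ ^ 2)
    (X : PBond (F.P K) 0 → Matrix (Fin 2) (Fin 2) ℂ) :
    ∑ c : PBond (F.P K) (K - n), ‖∑ r : Fin (F.P K).d → Fin ((F.P K).L ^ (K - n)), ∑ t ∈ range ((F.P K).L ^ (K - n)),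
        conjR (holT (unitsField (toUField U₀)) (Site.fibreSite 0 (K - n) c.src fun _ => ⟨0, pow_pos (F.P K).L_pos (K - n)⟩)
              (treeWord fun ν => ((r ν : ℕ) : ℤ))
            * holT (unitsField (toUField U₀)) (Site.fibreSite 0 (K - n) c.src r) (List.replicate t (c.dir, true)))
          (X ⟨(fun z : Site (F.P K) 0 => z.shift c.dir)^[t] (Site.fibreSite 0 (K - n) c.src r), c.dir⟩)‖ ^ 2
      ≤ CT * (((F.L : ℝ) ^ (K - n)) ^ (F.P K).d) ^ 2 * ∑ c' : PBond (F.P n) 0, ‖QTwS F n K h U₀ X c'‖ ^ 2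
        + Cq * ε₀ ^ 2 * (((F.L : ℝ) ^ (K - n)) ^ (F.P K).d * ((F.L : ℝ) ^ (K - n)) ^ 2) * ∑ b : PBond (F.P K) 0, ‖X b‖ ^ 2 := by
  have hα : 0 ≤ 2⁻¹ * CT * (((F.L : ℝ) ^ (K - n)) ^ (F.P K).d) ^ 2 := by positivity
  have hβ : 0 ≤ 2⁻¹ * Cq * ε₀ ^ 2 * (((F.L : ℝ) ^ (K - n)) ^ (F.P K).d * ((F.L : ℝ) ^ (K - n)) ^ 2) := by
    have hLpos : (0 : ℝ) < (F.L : ℝ) := by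
      have h3 : 3 ≤ F.L := by obtain ⟨a, ha⟩ := F.hL.1; have := F.hL.2; omega
      have : (3 : ℝ) ≤ (F.L : ℝ) := by exact_mod_cast h3
      linarith
    positivity
  have hmain := opRow_of_skewFrobRow F n K h hε₀ hWε U₀ hreg hα hβ hrow X
  have e1 : 2 * (2⁻¹ * CT * (((F.L : ℝ) ^ (K - n)) ^ (F.P K).d) ^ 2) = CT * (((F.L : ℝ) ^ (K - n)) ^ (F.P K).d) ^ 2 := by ring
  have e2 : 2 * (2⁻¹ * Cq * ε₀ ^ 2 * (((F.L : ℝ) ^ (K - n)) ^ (F.P K).d * ((F.L : ℝ) ^ (K - n)) ^ 2))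
      = Cq * ε₀ ^ 2 * (((F.L : ℝ) ^ (K - n)) ^ (F.P K).d * ((F.L : ℝ) ^ (K - n)) ^ 2) := by ring
  rw [e1, e2] at hmain
  exact hmain

end Summit.QuantumFields.YangMills.Theorems.Prop7TubeComparisonRowOfSkewRow

end
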